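import Literature.MathematicalPhysics.QuantumLattice.StrongExpDecayCentreSymmetry
import Literature.MathematicalPhysics.QuantumLattice.CentreSymmetryConfinementProofs
import HarnessLib

/-!
# The finite-slab kernels forget the spatial boundary condition exponentially fast under Chatterjee's
# Definition 2.3 (CMP 385 (2021), §12 ¶1, the quantitative statement)

S. Chatterjee, *A probabilistic mechanism for quark confinement*, CMP **385** (2021) [Chatterjee2021], §12, first paragraph:
«if `f` is a bounded measurable function of `{ω_e}_{e ∈ A}` for some fixed set `A`, then `|∫ f dμ − ∫ f dμ'|` falls off
exponentially in the distance of `A` from the spatial boundary of `S_{M,N}`» — for the lattice gauge theories `μ, μ'` on the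
finite slab `S_{M,N}` with two boundary conditions agreeing on the temporal faces. `StrongExpDecayCentreSymmetry.lean` used
this mechanism INSIDE the proof of slab uniqueness; this file EXPOSES it as a theorem about the tree's finite slabs
`slabBox n R` (`CentreSymmetryConfinementProofs.lean`: the interior links of `{0,…,n} × {−R,…,R}^{d−1}`), for use in the
quantitative half of Theorem 2.4 (`V(R)` grows linearly, eq. (12.1)) and by any other consumer of «strong mixing in slabs»:

* `exists_slabCubeWindowSystem` — the window system of all full-height cubes of side `n` of the slab (every interior slab
  link a centre), packaged with every hypothesis of the Dobrushin–Shlosman wrapper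
  `DobrushinShlosman.abs_integral_sub_integral_le_of_window_bulk` (weight `r ≡ 1`, ratio `γ₀ = 1/2`) and the geometric
  facts needed to build profiles, for all `n ≥ n₀(G, ρ, β, K₁, K₂, d)`;
* ★ `abs_integral_sub_integral_slabBox_le_of_strongExpDecayZd` — for `n ≥ n₀` there is `κ > 0` such that for every radius
  `R`, every two boundary conditions `ω, η` that AGREE OFF THE INTERIOR SLAB LINKS (i.e. on the temporal faces), and every
  bounded measurable `F` reading only `slabBox n R` whose unit-Lipschitz vector `δ` is supported on links of spatial
  sup-norm `≤ S₀`: `|γ_{slabBox n R} F(ω) − γ_{slabBox n R} F(η)| ≤ 2 e^{−κ ⌊(R − S₀ − 1)/(n+2)⌋} Σ δ`.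

## References
* S. Chatterjee, CMP 385 (2021), arXiv:2006.16229: §12 ¶1, §§9–11.
* R. L. Dobrushin, S. B. Shlosman (1985), Thm. 1.
-/

noncomputable section

open MeasureTheory Filter Function Finset
open scoped Topology

namespace Literature.MathematicalPhysics.QuantumLattice

open Literature.Probability.LatticeModels
open Literature.Probability.LatticeModels.DobrushinShlosman (abs_integral_sub_integral_le_of_window_bulk)

section Slab

variable {d N : ℕ} {G : Type*} [Group G] [TopologicalSpace G] [IsTopologicalGroup G]
  [CompactSpace G] [MeasurableSpace G] [BorelSpace G] [SecondCountableTopology G] [T2Space G] [NeZero d]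
  (ρ : G →* Matrix (Fin N) (Fin N) ℂ)

/-- **The influence profile** (copy of the private lemma of `StrongExpDecayCentreSymmetry.lean`). [folklore] -/
private theorem exists_influence_profile' {d : ℕ} (E₀ K₁ K₂ : ℝ) (hE₀ : 0 ≤ E₀) (hK₁ : 0 ≤ K₁)
    (hK₂ : 0 < K₂) :
    ∃ (κ : ℕ → ℝ) (A : ℝ), (∀ j, 0 ≤ κ j) ∧ (∀ j, j ≤ 4 → 2 ≤ κ j) ∧
      (∀ j, 5 ≤ j → E₀ * (2 * ((d * (4 * ((j - 1) / 4) + 1) ^ d : ℕ) *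
        (E₀ * (K₁ * Real.exp (-(K₂ * (2 * ((j - 1) / 4 : ℕ)))))))) ≤ κ j) ∧
      0 ≤ A ∧ ∀ n, ∑ k ∈ Finset.range (n + 1), ((d * (2 * k + 1) ^ d : ℕ) : ℝ) * κ k ≤ A := by
  set B : ℝ := (2 + 2 * d * (E₀ * E₀) * K₁) * Real.exp (2 * K₂) with hB
  have hB2 : 2 * Real.exp (2 * K₂) ≤ B := by
    rw [hB]
    refine mul_le_mul_of_nonneg_right ?_ (Real.exp_nonneg _)
    have : 0 ≤ 2 * (d : ℝ) * (E₀ * E₀) * K₁ := by positivity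
    linarith
  have hB0 : 0 ≤ B := by rw [hB]; positivity
  set κ : ℕ → ℝ := fun j => B * ((j + 1 : ℕ) : ℝ) ^ d * Real.exp (-(K₂ / 2) * j) with hκ
  have hκ0 : ∀ j, 0 ≤ κ j := fun j => by simp only [hκ]; positivity
  set D : ℝ := (d : ℝ) * 2 ^ d * B with hD
  set g : ℕ → ℝ := fun m => (m : ℝ) ^ (2 * d) * Real.exp (-(K₂ / 2) * m) with hg
  have hg_sum : Summable g := Real.summable_pow_mul_exp_neg_nat_mul (2 * d) (half_pos hK₂)
  set M : ℕ → ℝ := fun k => D * Real.exp (K₂ / 2) * g (k + 1) with hM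
  have hM_sum : Summable M := ((summable_nat_add_iff 1).2 hg_sum).mul_left _
  have hM0 : ∀ k, 0 ≤ M k := fun k => by simp only [hM, hg]; positivity
  have hterm : ∀ k : ℕ, ((d * (2 * k + 1) ^ d : ℕ) : ℝ) * κ k ≤ M k := by
    intro k
    have h1 : ((2 * k + 1 : ℕ) : ℝ) ^ d ≤ (2 : ℝ) ^ d * ((k + 1 : ℕ) : ℝ) ^ d := by
      rw [← mul_pow]
      exact pow_le_pow_left₀ (by positivity) (by push_cast; linarith) d
    simp only [hM, hg, hD, hκ]
    push_cast
    have hk1 : (0 : ℝ) ≤ (k : ℝ) + 1 := by positivity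
    calc ((d : ℝ) * (2 * (k : ℝ) + 1) ^ d) * (B * ((k : ℝ) + 1) ^ d * Real.exp (-(K₂ / 2) * k))
        ≤ ((d : ℝ) * ((2 : ℝ) ^ d * ((k : ℝ) + 1) ^ d)) * (B * ((k : ℝ) + 1) ^ d * Real.exp (-(K₂ / 2) * k)) := by
          refine mul_le_mul_of_nonneg_right (mul_le_mul_of_nonneg_left ?_ (Nat.cast_nonneg d)) (by positivity)
          have := h1; push_cast at this; exact this
      _ = (d : ℝ) * 2 ^ d * B * Real.exp (K₂ / 2) *
            (((k : ℝ) + 1) ^ (2 * d) * Real.exp (-(K₂ / 2) * ((k : ℝ) + 1))) := by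
          have e2 : Real.exp (-(K₂ / 2) * k) = Real.exp (K₂ / 2) * Real.exp (-(K₂ / 2) * ((k : ℝ) + 1)) := by
            rw [← Real.exp_add]; congr 1; ring
          have e3 : ((k : ℝ) + 1) ^ d * ((k : ℝ) + 1) ^ d = ((k : ℝ) + 1) ^ (2 * d) := by
            rw [← pow_add]; congr 1; ring
          rw [e2, ← e3]; ring
      _ = _ := by ring
  refine ⟨κ, ∑' k, M k, hκ0, fun j hj => ?_, fun j hj => ?_, tsum_nonneg hM0, fun n => ?_⟩
  · simp only [hκ]
    have hj' : (j : ℝ) ≤ 4 := by exact_mod_cast hj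
    have hpow : (1 : ℝ) ≤ ((j + 1 : ℕ) : ℝ) ^ d := one_le_pow₀ (by push_cast; linarith)
    calc (2 : ℝ) ≤ 2 * Real.exp (2 * K₂) * 1 * Real.exp (-(K₂ / 2) * j) := by
          have : Real.exp (2 * K₂) * Real.exp (-(K₂ / 2) * j) ≥ 1 := by
            rw [← Real.exp_add]; exact Real.one_le_exp (by nlinarith)
          nlinarith [Real.exp_pos (-(K₂ / 2) * j)]
      _ ≤ B * ((j + 1 : ℕ) : ℝ) ^ d * Real.exp (-(K₂ / 2) * j) :=
          mul_le_mul_of_nonneg_right (mul_le_mul hB2 hpow zero_le_one hB0) (Real.exp_nonneg _)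
  · set r : ℕ := (j - 1) / 4 with hr
    have h4r : 4 * r + 1 ≤ j + 1 := by omega
    have h4r' : j ≤ 4 * r + 4 := by omega
    simp only [hκ]
    have hpow : ((d * (4 * r + 1) ^ d : ℕ) : ℝ) ≤ (d : ℝ) * ((j + 1 : ℕ) : ℝ) ^ d := by
      have : (d * (4 * r + 1) ^ d : ℕ) ≤ d * (j + 1) ^ d :=
        Nat.mul_le_mul_left d (Nat.pow_le_pow_left h4r d)
      exact_mod_cast this
    have hexp : Real.exp (-(K₂ * (2 * (r : ℕ)))) ≤ Real.exp (2 * K₂) * Real.exp (-(K₂ / 2) * j) := by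
      rw [← Real.exp_add]
      refine Real.exp_le_exp.2 ?_
      have : (j : ℝ) ≤ 4 * r + 4 := by exact_mod_cast h4r'
      nlinarith
    calc E₀ * (2 * (((d * (4 * r + 1) ^ d : ℕ) : ℝ) * (E₀ * (K₁ * Real.exp (-(K₂ * (2 * (r : ℕ))))))))
        = 2 * (E₀ * E₀) * K₁ * (((d * (4 * r + 1) ^ d : ℕ) : ℝ)) * Real.exp (-(K₂ * (2 * (r : ℕ)))) := by ring
      _ ≤ 2 * (E₀ * E₀) * K₁ * ((d : ℝ) * ((j + 1 : ℕ) : ℝ) ^ d) *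
            (Real.exp (2 * K₂) * Real.exp (-(K₂ / 2) * j)) :=
          mul_le_mul (mul_le_mul_of_nonneg_left hpow (by positivity)) hexp (Real.exp_nonneg _) (by positivity)
      _ = (2 * d * (E₀ * E₀) * K₁ * Real.exp (2 * K₂)) * ((j + 1 : ℕ) : ℝ) ^ d * Real.exp (-(K₂ / 2) * j) := by
          ring
      _ ≤ B * ((j + 1 : ℕ) : ℝ) ^ d * Real.exp (-(K₂ / 2) * j) := by
          refine mul_le_mul_of_nonneg_right (mul_le_mul_of_nonneg_right ?_ (by positivity)) (Real.exp_nonneg _)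
          rw [hB]
          exact mul_le_mul_of_nonneg_right (by linarith) (Real.exp_nonneg _)
  · calc ∑ k ∈ Finset.range (n + 1), ((d * (2 * k + 1) ^ d : ℕ) : ℝ) * κ k
        ≤ ∑ k ∈ Finset.range (n + 1), M k := Finset.sum_le_sum fun k _ => hterm k
      _ ≤ ∑' k, M k := hM_sum.sum_le_tsum _ fun k _ => hM0 k

/-- ★ **The cube window system of the slab, packaged** (Chatterjee 2021 §§9–11 / Dobrushin–Shlosman's `C_V`): under
Def. 2.3 with constants `K₁`, `K₂ > 0` and `|Re tr ρ(U_p)| ≤ C` there is `n₀ ≥ 2` such that for every slab height `n ≥ n₀`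
the system «to every interior slab link `c` the interior `win c` of the cube `b(c) + {0,…,n}^d`, `b(c) = (0, c₁−1, …)`, its
link set `nbhd c`, the influence array `K`, the cover sets `cover x`» satisfies, with weight `r ≡ 1`, ratio `1/2` and some
crude bound `Γ ≥ 0`, every hypothesis of `DobrushinShlosman.abs_integral_sub_integral_le_of_window_bulk`
(non-negativity and support of `K`; the one-boundary-link contraction (H1); locality; `x ∈ win c ↔ c ∈ cover x`; the crude
and the averaged received-sum bounds, counting only boundary links interior to the slab; every interior slab link lies in
its own window), together with the geometry of the windows (centre, interior links and cube links are interior slab links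
resp. within spatial distance `n` of any link of the window, endpoints included; `K c y x ≠ 0` forces `x ∈ win c`,
`y ∈ nbhd c`). [cite: Chatterjee2021, §§9–11] -/
theorem exists_slabCubeWindowSystem (hρ : Continuous ρ) {C : ℝ} (hC0 : 0 ≤ C)
    (hC : ∀ (x : Site d) (i j : Fin d) (U : LGConfig d G), |plaquetteObs ρ x i j U| ≤ C)
    {β K₁ K₂ : ℝ} (hdecay : StrongExpDecayZd d ρ β K₁ K₂) (hK₂ : 0 < K₂) :
    ∃ n₀ : ℕ, 2 ≤ n₀ ∧ ∀ n, n₀ ≤ n →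
      ∃ (win nbhd cover : ZdEdge d → Finset (ZdEdge d)) (K : ZdEdge d → ZdEdge d → ZdEdge d → ℝ) (Γ : ℝ),
        0 ≤ Γ ∧ (∀ c y x, 0 ≤ K c y x) ∧ (∀ c y x, K c y x ≠ 0 → y ∈ nbhd c) ∧
        (∀ (c y : ZdEdge d), y ∉ win c → ∀ (ω η : LGConfig d G), (∀ v, v ≠ y → ω v = η v) →
          ∀ (f : LGConfig d G → ℝ) (δ : ZdEdge d → ℝ), Measurable f → (∃ B, ∀ σ, |f σ| ≤ B) →
            DependsOn f (win c : Set (ZdEdge d)) → (∀ x, 0 ≤ δ x) →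
            (∀ (x : ZdEdge d) (σ τ : LGConfig d G), (∀ v, v ≠ x → σ v = τ v) →
              |f σ - f τ| ≤ δ x * (fun _ _ : G => (1 : ℝ)) (σ x) (τ x)) →
              |∫ σ, f σ ∂(ymSpecification ρ β (win c) ω) - ∫ σ, f σ ∂(ymSpecification ρ β (win c) η)| ≤
                (∑ x ∈ win c, K c y x * δ x) * (fun _ _ : G => (1 : ℝ)) (ω y) (η y)) ∧
        (∀ (c : ZdEdge d) (ζ ζ' : LGConfig d G), (∀ v ∈ nbhd c, ζ v = ζ' v) →
          ∀ (f : LGConfig d G → ℝ), Measurable f → (∃ B, ∀ σ, |f σ| ≤ B) →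
            DependsOn f (win c : Set (ZdEdge d)) →
            ∫ σ, f σ ∂(ymSpecification ρ β (win c) ζ) = ∫ σ, f σ ∂(ymSpecification ρ β (win c) ζ')) ∧
        (∀ c x, x ∈ win c ↔ c ∈ cover x) ∧
        (∀ x, ∑ c ∈ cover x, ∑ y ∈ (nbhd c).filter (fun y => IsSlabInteriorEdge n y), K c y x ≤ Γ) ∧
        (∀ x, ∑ c ∈ cover x, ∑ y ∈ (nbhd c).filter (fun y => IsSlabInteriorEdge n y), K c y x ≤
          1 / 2 * (cover x).card) ∧
        (∀ c, IsSlabInteriorEdge n c → c ∈ win c) ∧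
        (∀ c x, x ∈ win c → IsSlabInteriorEdge n c ∧ (∀ k, k ≠ 0 → |c.1 k - x.1 k| ≤ n) ∧
          (∀ e ∈ win c, IsSlabInteriorEdge n e) ∧ win c ⊆ nbhd c ∧
          (∀ e ∈ nbhd c, ∀ k, k ≠ 0 → |e.1 k - x.1 k| ≤ n ∧
            |(e.1 + Pi.single e.2 (1 : ℤ) : Site d) k - x.1 k| ≤ n)) ∧
        (∀ c y x, K c y x ≠ 0 → x ∈ win c) := by
  classical
  have hd : 0 < d := Nat.pos_of_ne_zero (NeZero.ne d)
  have hK₁ : 0 ≤ K₁ := hdecay.nonneg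
  set E₀ : ℝ := Real.exp (2 * (|β| * (2 * C * (2 * (d - 1 : ℕ) : ℕ)))) with hE₀
  obtain ⟨κ, A, hκ0, hκ2, hκE, hA0, hA⟩ :=
    exists_influence_profile' (d := d) E₀ K₁ K₂ (Real.exp_nonneg _) hK₁ hK₂
  set M₀ : ℝ := 4 * d * ((d - 1 : ℕ) : ℝ) * 2 ^ (d - 1) * A with hM₀
  have hM₀0 : 0 ≤ M₀ := by rw [hM₀]; positivity
  refine ⟨⌈M₀⌉₊ + 3, by omega, fun n hn => ?_⟩
  have hn3 : 3 ≤ n := by omega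
  have hn2 : 2 ≤ n := by omega
  have hn1 : 1 ≤ n := by omega
  have hnM : M₀ ≤ (n : ℝ) - 1 := by
    have h1 : (⌈M₀⌉₊ : ℝ) + 3 ≤ n := by exact_mod_cast hn
    have h2 : M₀ ≤ ⌈M₀⌉₊ := Nat.le_ceil M₀
    linarith
  -- the window system
  let cubeInt : ZdEdge d → Finset (ZdEdge d) := fun c => (((Fintype.piFinset fun j : Fin d =>
      Finset.Icc ((fun j : Fin d => if j = 0 then (0 : ℤ) else c.1 j - 1) j)
        ((fun j : Fin d => if j = 0 then (0 : ℤ) else c.1 j - 1) j + n)) ×ˢ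
      (Finset.univ : Finset (Fin d))).filter fun e =>
        e.1 e.2 + 1 ≤ (fun j : Fin d => if j = 0 then (0 : ℤ) else c.1 j - 1) e.2 + n ∧
        ∀ j, j ≠ e.2 → (fun j : Fin d => if j = 0 then (0 : ℤ) else c.1 j - 1) j < e.1 j ∧
          e.1 j < (fun j : Fin d => if j = 0 then (0 : ℤ) else c.1 j - 1) j + n)
  let cubeEdges : ZdEdge d → Finset (ZdEdge d) := fun c => (((Fintype.piFinset fun j : Fin d =>
      Finset.Icc ((fun j : Fin d => if j = 0 then (0 : ℤ) else c.1 j - 1) j)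
        ((fun j : Fin d => if j = 0 then (0 : ℤ) else c.1 j - 1) j + n)) ×ˢ
      (Finset.univ : Finset (Fin d))).filter fun e =>
        e.1 e.2 + 1 ≤ (fun j : Fin d => if j = 0 then (0 : ℤ) else c.1 j - 1) e.2 + n)
  let win : ZdEdge d → Finset (ZdEdge d) := fun c => if IsSlabInteriorEdge n c then cubeInt c else ∅
  let nbhd : ZdEdge d → Finset (ZdEdge d) := fun c => if IsSlabInteriorEdge n c then cubeEdges c else ∅
  let K : ZdEdge d → ZdEdge d → ZdEdge d → ℝ := fun c y x =>
    if IsSlabInteriorEdge n c ∧ x ∈ cubeInt c ∧ y ∉ cubeInt c ∧ y ∈ cubeEdges c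
    then κ ⌊‖x.1 - y.1‖⌋₊ else 0
  let cover : ZdEdge d → Finset (ZdEdge d) := fun x => ((Fintype.piFinset fun j : Fin d =>
      if j = 0 then Finset.Icc (0 : ℤ) n else Finset.Icc (x.1 j + 1 - n) (x.1 j + 1)) ×ˢ
    (Finset.univ : Finset (Fin d))).filter fun c => IsSlabInteriorEdge n c ∧ x ∈ win c
  have hwin_pos : ∀ c, IsSlabInteriorEdge n c → win c = cubeInt c := fun c hc => if_pos hc
  have hnbhd_pos : ∀ c, IsSlabInteriorEdge n c → nbhd c = cubeEdges c := fun c hc => if_pos hc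
  have hwin_neg : ∀ c, ¬ IsSlabInteriorEdge n c → win c = ∅ := fun c hc => if_neg hc
  have hint_sub_edges : ∀ c, cubeInt c ⊆ cubeEdges c := by
    intro c u hu
    simp only [cubeInt, cubeEdges, Finset.mem_filter] at hu ⊢
    exact ⟨hu.1, hu.2.1⟩
  have hmemInt : ∀ c u, u ∈ cubeInt c ↔ (∀ j, (fun j : Fin d => if j = 0 then (0 : ℤ) else c.1 j - 1) j ≤ u.1 j ∧
      u.1 j ≤ (fun j : Fin d => if j = 0 then (0 : ℤ) else c.1 j - 1) j + n) ∧
      u.1 u.2 + 1 ≤ (fun j : Fin d => if j = 0 then (0 : ℤ) else c.1 j - 1) u.2 + n ∧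
      ∀ j, j ≠ u.2 → (fun j : Fin d => if j = 0 then (0 : ℤ) else c.1 j - 1) j < u.1 j ∧
        u.1 j < (fun j : Fin d => if j = 0 then (0 : ℤ) else c.1 j - 1) j + n := fun c u => by
    simp only [cubeInt, Finset.mem_filter, Finset.mem_product, Fintype.mem_piFinset, Finset.mem_Icc,
      Finset.mem_univ, and_true]
  have hmemEdges : ∀ c u, u ∈ cubeEdges c ↔ (∀ j, (fun j : Fin d => if j = 0 then (0 : ℤ) else c.1 j - 1) j ≤ u.1 j ∧
      u.1 j ≤ (fun j : Fin d => if j = 0 then (0 : ℤ) else c.1 j - 1) j + n) ∧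
      u.1 u.2 + 1 ≤ (fun j : Fin d => if j = 0 then (0 : ℤ) else c.1 j - 1) u.2 + n := fun c u => by
    simp only [cubeEdges, Finset.mem_filter, Finset.mem_product, Fintype.mem_piFinset, Finset.mem_Icc,
      Finset.mem_univ, and_true]
  have hKwin : ∀ c y x, K c y x ≠ 0 → IsSlabInteriorEdge n c ∧ x ∈ win c ∧ y ∈ nbhd c ∧ y ∉ win c := by
    intro c y x hK
    by_cases h : IsSlabInteriorEdge n c ∧ x ∈ cubeInt c ∧ y ∉ cubeInt c ∧ y ∈ cubeEdges c
    · rw [hwin_pos c h.1, hnbhd_pos c h.1]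
      exact ⟨h.1, h.2.1, h.2.2.2, h.2.2.1⟩
    · exact absurd (if_neg h) hK
  have hγ := QuantumFieldTheory.isSpecification_ymSpecification_of_t2Space (d := d) ρ hρ β
  have hconst : ∀ (Λ : Finset (ZdEdge d)) (ζ ζ' : LGConfig d G) (f : LGConfig d G → ℝ),
      DependsOn f ((∅ : Finset (ZdEdge d)) : Set (ZdEdge d)) →
      ∫ U, f U ∂(ymSpecification ρ β Λ ζ) = ∫ U, f U ∂(ymSpecification ρ β Λ ζ') := by
    intro Λ ζ ζ' f hf
    haveI := hγ.isProbability Λ ζ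
    haveI := hγ.isProbability Λ ζ'
    have hc : ∀ U, f U = f ζ := fun U => hf (by simp)
    rw [show (fun U => f U) = fun _ => f ζ from funext hc]
    simp
  have hrecv : ∀ x, ∑ c ∈ cover x, ∑ y ∈ (nbhd c).filter (fun y => IsSlabInteriorEdge n y), K c y x ≤
      (2 * d * (d - 1) * (n + 1) ^ (d - 1) : ℕ) * ∑ k ∈ Finset.range (n + 1), (d * (2 * k + 1) ^ d : ℕ) * κ k :=
    fun x => sum_cover_boundary_influence_le hκ0 n x win nbhd cover K hwin_pos hnbhd_pos
      (fun c y hc hxc hyc => by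
        rw [hwin_pos c hc] at hxc ⊢
        rw [hnbhd_pos c hc] at hyc
        simp only [K]
        by_cases hyi : y ∈ cubeInt c
        · rw [if_neg (fun h => h.2.2.1 hyi), if_neg (not_not.2 hyi)]
        · rw [if_pos ⟨hc, hxc, hyi, hyc⟩, if_pos hyi]) rfl
  refine ⟨win, nbhd, cover, K, (2 * d * (d - 1) * (n + 1) ^ (d - 1) : ℕ) * A, by positivity,
    ?hK0, fun c y x hK => (hKwin c y x hK).2.2.1, ?hcontract, ?hloc,
    fun c x => mem_cover_iff n win cover (fun c => rfl) (fun x => rfl) c x, fun x =>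
      (hrecv x).trans (mul_le_mul_of_nonneg_left (hA n) (Nat.cast_nonneg _)), ?hsum,
    fun c hc => by rw [hwin_pos c hc]; exact self_mem_cubeInterior_base hn2 hc rfl, ?hgeom,
    fun c y x hK => (hKwin c y x hK).2.1⟩
  case hK0 =>
    intro c y x
    simp only [K]
    split_ifs
    · exact hκ0 _
    · exact le_rfl
  case hcontract =>
    intro c y hy ω η hωη f δ' hfm hfB hfdep hδ0 hlip
    rw [mul_one]
    obtain ⟨B, hB⟩ := hfB
    have hlip' : ∀ (x : ZdEdge d) (σ τ : LGConfig d G), (∀ e, e ≠ x → σ e = τ e) → |f σ - f τ| ≤ δ' x :=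
      fun x σ τ h => by simpa using hlip x σ τ h
    by_cases hc : IsSlabInteriorEdge n c
    · rw [hwin_pos c hc] at hy hfdep ⊢
      have key := abs_integral_sub_integral_le_cube_influence ρ hρ hC0 hC hdecay hK₂.le n
        (fun j : Fin d => if j = 0 then (0 : ℤ) else c.1 j - 1) (cubeInt c) rfl κ hκ0 hκ2 hκE y hy ω η hωη
        hfm hB hfdep hδ0 hlip'
      refine key.trans (le_of_eq (Finset.sum_congr rfl fun x hx => ?_))
      congr 1
      simp only [K]
      by_cases hyE : y ∈ cubeEdges c
      · rw [if_pos ((hmemEdges c y).1 hyE), if_pos ⟨hc, hx, hy, hyE⟩]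
      · rw [if_neg (fun h => hyE ((hmemEdges c y).2 h)), if_neg (fun h => hyE h.2.2.2)]
    · rw [hwin_neg c hc] at hfdep ⊢
      rw [hconst _ ω η f hfdep, sub_self, abs_zero, Finset.sum_empty]
  case hloc =>
    intro c ζ ζ' hζ f hfm hfB hfdep
    by_cases hc : IsSlabInteriorEdge n c
    · rw [hwin_pos c hc] at hfdep ⊢
      rw [hnbhd_pos c hc] at hζ
      exact integral_ymSpecification_cube_congr ρ hρ β rfl hfm hfdep fun u hu1 hu2 =>
        hζ u ((hmemEdges c u).2 ⟨hu1, hu2⟩)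
    · rw [hwin_neg c hc] at hfdep ⊢
      exact hconst _ ζ ζ' f hfdep
  case hsum =>
    intro x
    by_cases hxW : IsSlabInteriorEdge n x
    · have hcard := le_card_cover hn2 win cover (fun c => rfl) (fun x => rfl) hxW
      refine (hrecv x).trans ((mul_le_mul_of_nonneg_left (hA n) (Nat.cast_nonneg _)).trans ?_)
      have hcard' : (((n - 1) ^ d : ℕ) : ℝ) ≤ (cover x).card := by exact_mod_cast hcard
      refine le_trans ?_ (mul_le_mul_of_nonneg_left hcard' (by norm_num))
      have hn1' : (1 : ℝ) ≤ n := by exact_mod_cast hn1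
      have e1 : (((n - 1) ^ d : ℕ) : ℝ) = ((n : ℝ) - 1) ^ d := by
        rw [Nat.cast_pow, Nat.cast_sub hn1]; push_cast; ring
      rw [e1]
      obtain ⟨d', hd'⟩ : ∃ d', d = d' + 1 := ⟨d - 1, by omega⟩
      have hdsub : d - 1 = d' := by omega
      rw [hdsub]
      push_cast
      rw [hd', pow_succ]
      have hn3' : (3 : ℝ) ≤ n := by exact_mod_cast hn3
      have h2 : ((n : ℝ) + 1) ^ d' ≤ (2 : ℝ) ^ d' * ((n : ℝ) - 1) ^ d' := by
        rw [← mul_pow]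
        exact pow_le_pow_left₀ (by positivity) (by linarith) d'
      have h3 : 0 ≤ ((n : ℝ) - 1) ^ d' := pow_nonneg (by linarith) d'
      have hd'c : ((d' + 1 : ℕ) : ℝ) = (d' : ℝ) + 1 := by push_cast; ring
      rw [hM₀, hdsub, hd'] at hnM
      have h4 : 2 * ((d' : ℝ) + 1) * (d' : ℝ) * ((n : ℝ) + 1) ^ d' * A ≤
          2 * ((d' : ℝ) + 1) * (d' : ℝ) * ((2 : ℝ) ^ d' * ((n : ℝ) - 1) ^ d') * A :=
        mul_le_mul_of_nonneg_right (mul_le_mul_of_nonneg_left h2 (by positivity)) hA0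
      push_cast at hnM
      have h5 : 2 * ((d' : ℝ) + 1) * (d' : ℝ) * ((2 : ℝ) ^ d' * ((n : ℝ) - 1) ^ d') * A =
          (4 * ((d' : ℝ) + 1) * (d' : ℝ) * 2 ^ d' * A) * ((n : ℝ) - 1) ^ d' / 2 := by ring
      rw [hd'c]
      calc 2 * ((d' : ℝ) + 1) * (d' : ℝ) * ((n : ℝ) + 1) ^ d' * A
          ≤ (4 * ((d' : ℝ) + 1) * (d' : ℝ) * 2 ^ d' * A) * ((n : ℝ) - 1) ^ d' / 2 := h4.trans (le_of_eq h5)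
        _ ≤ ((n : ℝ) - 1) * ((n : ℝ) - 1) ^ d' / 2 := by
            have := mul_le_mul_of_nonneg_right hnM h3
            linarith
        _ = 1 / 2 * (((n : ℝ) - 1) ^ d' * ((n : ℝ) - 1)) := by ring
    · have hempty : cover x = ∅ := by
        refine Finset.eq_empty_of_forall_notMem fun c hc => hxW ?_
        have hxc : x ∈ win c := (mem_cover_iff n win cover (fun c => rfl) (fun x => rfl) c x).2 hc
        by_cases hc : IsSlabInteriorEdge n c
        · rw [hwin_pos c hc] at hxc
          exact isSlabInteriorEdge_of_mem_cubeInterior (v := fun j : Fin d =>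
            if j = 0 then (0 : ℤ) else c.1 j - 1) (by simp) rfl hxc
        · rw [hwin_neg c hc] at hxc
          exact absurd hxc (Finset.notMem_empty x)
      rw [hempty]
      simp
  case hgeom =>
    intro c x hxc
    by_cases hc : IsSlabInteriorEdge n c
    · rw [hwin_pos c hc] at hxc
      have hx' := (hmemInt c x).1 hxc
      rw [hwin_pos c hc, hnbhd_pos c hc]
      refine ⟨hc, fun k hk => ?_, fun e he => isSlabInteriorEdge_of_mem_cubeInterior (v := fun j : Fin d =>
        if j = 0 then (0 : ℤ) else c.1 j - 1) (by simp) rfl he, hint_sub_edges c, fun e he k hk => ?_⟩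
      · have h1 := hx'.1 k
        simp only [if_neg hk] at h1
        rw [abs_le]; constructor <;> omega
      · have he' := (hmemEdges c e).1 he
        have h1 := hx'.1 k
        have h2 := he'.1 k
        have h3 := he'.2
        simp only [if_neg hk] at h1 h2
        refine ⟨by rw [abs_le]; constructor <;> omega, ?_⟩
        rw [Pi.add_apply]
        by_cases hke : k = e.2
        · subst hke
          simp only [if_neg hk] at h3
          rw [Pi.single_eq_same, abs_le]; constructor <;> omega
        · rw [Pi.single_eq_of_ne hke, add_zero, abs_le]; constructor <;> omega
    · rw [hwin_neg c hc] at hxc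
      exact absurd hxc (Finset.notMem_empty x)

/-! ### The finite-slab kernels forget the spatial boundary condition -/

/-- ★ **Chatterjee 2021, §12 ¶1, quantitative: the finite-slab kernels forget the spatial boundary condition
exponentially fast in the distance to the spatial boundary.** Under Def. 2.3 with constants `K₁`, `K₂ > 0` and
`|Re tr ρ(U_p)| ≤ C` there is `n₀ ≥ 2` such that for every slab height `n ≥ n₀` some `κ > 0` satisfies: for every radius `R`,
all boundary conditions `ω, η` that agree at every link which is NOT an interior slab link (i.e. on the temporal faces and
outside the slab — the spatial boundary values are arbitrary), every bounded measurable `F` reading only the finite slab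
`slabBox n R`, and every unit-Lipschitz vector `δ` of `F` (`|F σ − F τ| ≤ δ x` for `σ = τ` off `x`) supported on links of
spatial sup-norm `≤ S₀`:
`|∫ F dγ_{slabBox n R}(·|ω) − ∫ F dγ_{slabBox n R}(·|η)| ≤ 2 e^{−κ ⌊(R − S₀ − 1)/(n+2)⌋} Σ_{x ∈ slabBox n R} δ x`.
Proof: `DobrushinShlosman.abs_integral_sub_integral_le_of_window_bulk` for the packaged cube window system with the profile
`ℓ(x) = ⌊(R − 1 − max_{k≠0}|x_k|)/(n+2)⌋`. [cite: Chatterjee2021, §12 (first paragraph)] -/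
theorem abs_integral_sub_integral_slabBox_le_of_strongExpDecayZd (hρ : Continuous ρ) {C : ℝ} (hC0 : 0 ≤ C)
    (hC : ∀ (x : Site d) (i j : Fin d) (U : LGConfig d G), |plaquetteObs ρ x i j U| ≤ C)
    {β K₁ K₂ : ℝ} (hdecay : StrongExpDecayZd d ρ β K₁ K₂) (hK₂ : 0 < K₂) :
    ∃ n₀ : ℕ, 2 ≤ n₀ ∧ ∀ n, n₀ ≤ n → ∃ κ : ℝ, 0 < κ ∧
      ∀ (R S₀ : ℕ) (ω η : LGConfig d G), (∀ e, ¬ IsSlabInteriorEdge n e → ω e = η e) →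
      ∀ (F : LGConfig d G → ℝ), Measurable F → (∃ B, ∀ σ, |F σ| ≤ B) →
        DependsOn F (↑(slabBox (d := d) n R) : Set (ZdEdge d)) →
      ∀ (δ : ZdEdge d → ℝ), (∀ x, 0 ≤ δ x) →
        (∀ (x : ZdEdge d) (σ τ : LGConfig d G), (∀ e, e ≠ x → σ e = τ e) → |F σ - F τ| ≤ δ x) →
        (∀ x, δ x ≠ 0 → ∀ k : Fin d, k ≠ 0 → |x.1 k| ≤ (S₀ : ℤ)) →
        |(∫ U, F U ∂(ymSpecification ρ β (slabBox n R) ω)) - ∫ U, F U ∂(ymSpecification ρ β (slabBox n R) η)| ≤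
          2 * Real.exp (-(κ * (((R - S₀ - 1) / (n + 2) : ℕ) : ℝ))) * ∑ x ∈ slabBox n R, δ x := by
  classical
  obtain ⟨n₀, hn₀, hsys⟩ := exists_slabCubeWindowSystem ρ hρ hC0 hC hdecay hK₂
  refine ⟨n₀, hn₀, fun n hn => ?_⟩
  have hn2 : 2 ≤ n := hn₀.trans hn
  obtain ⟨win, nbhd, cover, K, Γ, hΓ, hK0, hKsupp, hcontract, hloc, hcover, hsum0, hsum, hself, hgeom, hKx⟩ :=
    hsys n hn
  set κ₁ : ℝ := (1 - 1 / 2) ^ 2 / (2 * (2 * Γ + 1)) with hκ₁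
  refine ⟨κ₁, by rw [hκ₁]; positivity, ?_⟩
  intro R S₀ ω η hωη F hFm hFB hFdep δ hδ0 hδ hδS
  have hγ := QuantumFieldTheory.isSpecification_ymSpecification_of_t2Space (d := d) ρ hρ β
  obtain ⟨B, hB⟩ := hFB
  -- the spatial sup norm and the profile
  set Sp : ZdEdge d → ℕ := fun e => Finset.univ.sup fun j : Fin d => if j = 0 then 0 else (e.1 j).natAbs
    with hSp
  have hSp_le : ∀ (e : ZdEdge d) (m : ℕ), (∀ j, j ≠ 0 → (e.1 j).natAbs ≤ m) → Sp e ≤ m := by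
    intro e m h
    refine Finset.sup_le fun j _ => ?_
    by_cases hj : j = 0
    · simp [hj]
    · simp only [if_neg hj]; exact h j hj
  have hle_Sp : ∀ (e : ZdEdge d) (j : Fin d), j ≠ 0 → (e.1 j).natAbs ≤ Sp e := by
    intro e j hj
    have := Finset.le_sup (f := fun j : Fin d => if j = 0 then 0 else (e.1 j).natAbs) (Finset.mem_univ j)
    simp only [if_neg hj] at this
    exact this
  set ℓ : ZdEdge d → ℕ := fun e => (R - 1 - Sp e) / (n + 2) with hℓ
  -- membership in the slab box from spatial control
  have hmem_of : ∀ (e x : ZdEdge d), IsSlabInteriorEdge n e →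
      (∀ k : Fin d, k ≠ 0 → |e.1 k - x.1 k| ≤ n ∧ |(e.1 + Pi.single e.2 (1 : ℤ) : Site d) k - x.1 k| ≤ n) →
      Sp x + n + 2 ≤ R → e ∈ slabBox n R := by
    intro e x he hk hR
    refine mem_slabBox.2 ⟨he, fun k hk0 => ?_, fun k hk0 => ?_⟩
    · have h1 := (hk k hk0).1
      have h2 := hle_Sp x k hk0
      have h3 : |x.1 k| = ((x.1 k).natAbs : ℤ) := (Int.natCast_natAbs _).symm
      have h4 : |e.1 k| ≤ |e.1 k - x.1 k| + |x.1 k| := by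
        have := abs_add_le (e.1 k - x.1 k) (x.1 k); rwa [sub_add_cancel] at this
      omega
    · have h1 := (hk k hk0).2
      have h2 := hle_Sp x k hk0
      have h3 : |x.1 k| = ((x.1 k).natAbs : ℤ) := (Int.natCast_natAbs _).symm
      have h4 : |(e.1 + Pi.single e.2 (1 : ℤ) : Site d) k| ≤
          |(e.1 + Pi.single e.2 (1 : ℤ) : Site d) k - x.1 k| + |x.1 k| := by
        have := abs_add_le ((e.1 + Pi.single e.2 (1 : ℤ) : Site d) k - x.1 k) (x.1 k)
        rwa [sub_add_cancel] at this
      omega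
  have key := abs_integral_sub_integral_le_of_window_bulk hγ (r := fun _ _ : G => (1 : ℝ)) (R := 1)
    (fun _ _ => zero_le_one) (fun _ _ => le_rfl) zero_le_one hK0 hKsupp hcontract hloc
    {e | IsSlabInteriorEdge n e} cover hcover (γ₀ := 1 / 2) (Γ := Γ) (by norm_num) (by norm_num) hΓ hsum0 hsum
    (slabBox n R) (fun e he => isSlabInteriorEdge_of_mem_slabBox (Finset.mem_coe.1 he))
    (fun c hc => hself c (isSlabInteriorEdge_of_mem_slabBox hc)) ω η ℓ ((R - S₀ - 1) / (n + 2))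
    ?hU ?hℓ hFm hB hFdep (δ := δ) ⟨hδ0, fun x σ τ h => by simpa using hδ x σ τ h⟩ ?hδL
  case hU =>
    intro x hx c hxc
    obtain ⟨hc, hcx, hwinW, hwinsub, hnb⟩ := hgeom c x hxc
    have hRx : Sp x + n + 2 ≤ R := by
      by_contra h
      apply hx
      simp only [hℓ]
      apply Nat.div_eq_of_lt
      omega
    refine ⟨?_, fun e he => hmem_of e x (hwinW e he) (hnb e (hwinsub he)) hRx, fun v hv hvΛ =>
      hωη v fun hvW => hvΛ (hmem_of v x hvW (hnb v hv) hRx)⟩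
    -- the centre `c`: spatial coordinates within `n` of `x`, endpoint within `n` as well (`n ≥ 2`)
    refine mem_slabBox.2 ⟨hc, fun k hk0 => ?_, fun k hk0 => ?_⟩
    · have h1 := hcx k hk0
      have h2 := hle_Sp x k hk0
      have h3 : |x.1 k| = ((x.1 k).natAbs : ℤ) := (Int.natCast_natAbs _).symm
      have h4 : |c.1 k| ≤ |c.1 k - x.1 k| + |x.1 k| := by
        have := abs_add_le (c.1 k - x.1 k) (x.1 k); rwa [sub_add_cancel] at this
      omega
    · have h1 := hcx k hk0
      have h2 := hle_Sp x k hk0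
      have h3 : |x.1 k| = ((x.1 k).natAbs : ℤ) := (Int.natCast_natAbs _).symm
      have h5 : |(c.1 + Pi.single c.2 (1 : ℤ) : Site d) k| ≤ |c.1 k| + 1 := by
        rw [Pi.add_apply]
        refine (abs_add_le _ _).trans (add_le_add le_rfl ?_)
        by_cases hke : k = c.2
        · subst hke; simp
        · simp [Pi.single_eq_of_ne hke]
      have h4 : |c.1 k| ≤ |c.1 k - x.1 k| + |x.1 k| := by
        have := abs_add_le (c.1 k - x.1 k) (x.1 k); rwa [sub_add_cancel] at this
      have hn2' : (2 : ℤ) ≤ n := by exact_mod_cast hn2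
      omega
  case hℓ =>
    intro c x y hxc hK
    have hy := hKsupp c y x hK
    obtain ⟨-, -, -, -, hnb⟩ := hgeom c x hxc
    have hyx : Sp y ≤ Sp x + n := hSp_le y _ fun k hk => by
      have h1 := (hnb y hy k hk).1
      have h2 := hle_Sp x k hk
      rw [abs_le] at h1
      omega
    simp only [hℓ]
    have h1 : R - 1 - Sp x ≤ (R - 1 - Sp y) + (n + 2) := by omega
    calc (R - 1 - Sp x) / (n + 2) ≤ ((R - 1 - Sp y) + (n + 2)) / (n + 2) := Nat.div_le_div_right h1
      _ = (R - 1 - Sp y) / (n + 2) + 1 := Nat.add_div_right _ (by omega)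
  case hδL =>
    intro x hx
    by_contra hδx
    have hSx : Sp x ≤ S₀ := hSp_le x S₀ fun k hk => by
      have := hδS x hδx k hk
      have h3 : |x.1 k| = ((x.1 k).natAbs : ℤ) := (Int.natCast_natAbs _).symm
      omega
    apply not_le.2 hx
    simp only [hℓ]
    exact Nat.div_le_div_right (by omega)
  have e : (1 - (1 : ℝ) / 2) ^ 2 / (2 * (2 * Γ + 1)) = κ₁ := rfl
  rw [e, mul_one] at key
  simpa using key

end Slab

end Literature.MathematicalPhysics.QuantumLattice

end
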